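import Summits.QuantumFields.BalabanUV.Beta.SymAveragingMixedJetStructure

/-!
# `BalabanUV.Beta.SymAveragingMixedJetTables` — part 3 (umbrella): THE PACKED (0.4)-SYMMETRISED SECOND-ORDER KERNELS `symMixFFAt` (Q-C1 shape)
# AND `symVh₂SAt` (Q-C3 shape), their block-translation covariance (Tmix)(TB) and bi-localisation (Lmix)(LB) for every rate `δ ≥ 0`

HONEST FRAMING (cell contract, verbatim): «discharging `BetaPertH` makes Bałaban's UV stability UNCONDITIONAL — a real constructive-QFT
result; it is NOT the continuum limit and NOT the Clay problem.»  THIS MODULE DISCHARGES NOTHING of `BetaPertH` ∕ row D1: [folklore] packing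
and localisation algebra, the `S_d × S_d` version of node 12b `Beta.AveragingMixedJetTables` §7 (same statements, same proofs, over part 2's
symmetrised tables; node 7a's packer `packVH` and its entry ∕ symmetry lemmas BY NAME).  0 sorry, 0 `def … : Prop`, nothing cited as a fact.
NOT D1, NOT BetaPertH, NOT continuum, NOT Clay.

WHAT ([folklore] throughout; importing this file imports parts 1–2, the namespace spans the three files):
* the real kernels `symMixKerAt ρ L μ y g f f′ := symTTab …` (background bond FIRST) and `symVh2KerAt ρ L μ y f g h := symVh2Tab …`, covariance;
* **(Q-C1) `symMixFFAt ρ L κ u μ y`** — the symmetrised mixed table packed on the field–field block (the TYPE of the field `mixFF` of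
  `SymmetrisedStepJets.SymTables`, = an2's `M₂ κ u μ y`): entry `((x, inl α), (x′, inl α′)) ↦ t_sym((α,x),(α′,x′); (κ,u))`, `0` elsewhere;
* **(Q-C3) `symVh₂SAt ρ L κ u κ′ u′`** — node 7a's packer applied to `s_sym` with the FIRST background bond `(κ,u)` closed over (the TYPE of the
  field `vh₂S`; slot dictionary as node 12b: first kernel slot = the fluctuation leg `(α, x)`, second = the stencil index `(κ′, u′)`);
* **(Tmix)(TB)** `symMixFFAt_translate` (all roots), `symVh₂SAt_translate` (`1 ≤ L`, all roots) in the byte shapes of the record's `hmixt` ∕ `hBt`;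
* **(Lmix)(LB)** `biLoc_symMixFFAt`, `biLoc_symVh₂SAt`: for a root offset in the box and EVERY `δ ≥ 0`, the bodies of `LocStencilFM L (symMixFFAt ρ L) C δ`
  and `LocStencil₂ (symVh₂SAt ρ L) C δ` with the honest constants `symMixAbs ρ L · e^{6(d+1)Lδ}`, `symVh2Abs ρ L · e^{6(d+1)Lδ}`; `symVh₂SAt_symm`.
The record-shape letters (`∃ C δ, 0 < δ ∧ LocStencil₂ …`, `… LocStencilFM …`) and the hypothesis-free `SymTables d Lc` instance are in
`SymSecondOrderTablesAn1` (which imports the stencil vocabularies); this file keeps node 12b's import footprint.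
NOT HERE: any value of any table, the Ward laws (T2-B)(T2-M₂), reflection letters, any estimate beyond finiteness.
HONEST DEPENDENCY (verbatim): «continuum YM on T⁴ ⇐ BetaPertH ∧ nine spine estimates (0/9 proved); BetaPertH ⇐ (D1) ∧ (D4) ∧ CAP+tail;
G-an2-4 gates asym, D1 and NE2/3/4.»  ABSOLUTE RULE (cell, verbatim): «No internally-minted statement may enter as a cited fact. Every
hypothesis is either kernel-proved in this package or a verbatim quotation of a PUBLISHED theorem with page reference.»
Provenance: β sub-cell, W-supplier `b2b-balaban-beta-an1` gen 43 (scratch for courier by the row-D1 owner), 2026-08-21; no existing file touched.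
-/

namespace Summit.QuantumFields.BalabanUV.Beta.SymAveragingMixedJetTables

open Finset
open scoped BigOperators
open Literature.MathematicalPhysics.QuantumFieldTheory.Balaban1983to89
open Literature.MathematicalPhysics.QuantumFieldTheory.Balaban1983to89.Beta
open Literature.MathematicalPhysics.QuantumFieldTheory.Balaban1983to89.Beta.AffineAveraging
open Literature.MathematicalPhysics.QuantumFieldTheory.Balaban1983to89.Beta.AveragingContours
open Literature.MathematicalPhysics.QuantumFieldTheory.Balaban1983to89.Beta.AveragingContoursRooted
open Literature.MathematicalPhysics.QuantumFieldTheory.Balaban1983to89.Beta.TransportedContourVariables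
open Literature.MathematicalPhysics.QuantumFieldTheory.Balaban1983to89.Beta.AveragingHessianKernels
open Literature.MathematicalPhysics.QuantumFieldTheory.Balaban1983to89.Beta.AveragingHessianKernelsRooted
open Literature.MathematicalPhysics.QuantumFieldTheory.Balaban1983to89.Beta.AveragingMixedJetTables

noncomputable section

/-! ## §8 The packed kernels `symMixFFAt` (Q-C1) and `symVh₂SAt` (Q-C3) -/

section Packed

open ExpKernelCalculus (MKer BiLoc shiftK)
open OneStepResolventKernel (Fib LocStencil)
open B12Sec2to5 (l1 l1_nonneg)

variable {d : ℕ}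

/-- [folklore] THE REAL SYMMETRISED MIXED KERNEL `t^{ρ,sym}_b(f, f′; g)` (background bond `g` FIRST, then the ordered fluctuation pair). -/
def symMixKerAt (ρ : Fin d → ℤ) (L : ℕ) (μ : Fin d) (y : Fin d → ℤ) (g f f' : Bond d) : ℝ := (symTTab ρ L μ y f f' g : ℝ)

/-- [folklore] THE REAL SYMMETRISED `T₂` BORDER KERNEL `s^{ρ,sym}_b(f; g, h)` (fluctuation `f`, backgrounds `g`, `h`). -/
def symVh2KerAt (ρ : Fin d → ℤ) (L : ℕ) (μ : Fin d) (y : Fin d → ℤ) (f g h : Bond d) : ℝ := (symVh2Tab ρ L μ y f g h : ℝ)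

/-- [folklore] Block covariance of `symMixKerAt`. -/
theorem symMixKerAt_add (ρ : Fin d → ℤ) (L : ℕ) (μ : Fin d) (y t : Fin d → ℤ) (g f f' : Bond d) :
    symMixKerAt ρ L μ (y + t) (g.sh ((L : ℤ) • t)) (f.sh ((L : ℤ) • t)) (f'.sh ((L : ℤ) • t)) = symMixKerAt ρ L μ y g f f' := by
  rw [symMixKerAt, symMixKerAt, symTTab_add]

/-- [folklore] Block covariance of `symVh2KerAt`. -/
theorem symVh2KerAt_add (ρ : Fin d → ℤ) (L : ℕ) (μ : Fin d) (y t : Fin d → ℤ) (f g h : Bond d) :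
    symVh2KerAt ρ L μ (y + t) (f.sh ((L : ℤ) • t)) (g.sh ((L : ℤ) • t)) (h.sh ((L : ℤ) • t)) = symVh2KerAt ρ L μ y f g h := by
  rw [symVh2KerAt, symVh2KerAt, symVh2Tab_add]

/-- [our object] **(Q-C1) THE SYMMETRISED MIXED TABLE PACKED ON THE FIELD–FIELD BLOCK** (sym twin of `mixFFAt`; the record's `mixFF κ u μ y`): entry
`((x, inl α), (x′, inl α′)) ↦ t^{ρ,sym}_{(μ,y)}((α,x), (α′,x′); (κ,u))`, `0` elsewhere. -/
def symMixFFAt (ρ : Fin (d + 1) → ℤ) (L : ℕ) (κ : Fin (d + 1)) (u : Fin (d + 1) → ℤ) (μ : Fin (d + 1)) (y : Fin (d + 1) → ℤ) :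
    MKer (d + 1) (Fib d) := fun x x' a b =>
  match a, b with
  | Sum.inl α, Sum.inl α' => symMixKerAt ρ L μ y (κ, u) (α, x) (α', x')
  | _, _ => 0

/-- [folklore] The field–field entries of `symMixFFAt`. -/
@[simp] theorem symMixFFAt_inl_inl (ρ : Fin (d + 1) → ℤ) (L : ℕ) (κ : Fin (d + 1)) (u : Fin (d + 1) → ℤ) (μ : Fin (d + 1))
    (y x x' : Fin (d + 1) → ℤ) (α α' : Fin (d + 1)) :
    symMixFFAt ρ L κ u μ y x x' (Sum.inl α) (Sum.inl α') = symMixKerAt ρ L μ y (κ, u) (α, x) (α', x') := rfl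

/-- [folklore] `symMixFFAt` vanishes on `(inl, inr)`. -/
@[simp] theorem symMixFFAt_inl_inr (ρ : Fin (d + 1) → ℤ) (L : ℕ) (κ : Fin (d + 1)) (u : Fin (d + 1) → ℤ) (μ : Fin (d + 1))
    (y x x' : Fin (d + 1) → ℤ) (α μ' : Fin (d + 1)) : symMixFFAt ρ L κ u μ y x x' (Sum.inl α) (Sum.inr μ') = 0 := rfl

/-- [folklore] `symMixFFAt` vanishes on `(inr, ·)`. -/
@[simp] theorem symMixFFAt_inr (ρ : Fin (d + 1) → ℤ) (L : ℕ) (κ : Fin (d + 1)) (u : Fin (d + 1) → ℤ) (μ : Fin (d + 1))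
    (y x x' : Fin (d + 1) → ℤ) (μ' : Fin (d + 1)) (b : Fib d) : symMixFFAt ρ L κ u μ y x x' (Sum.inr μ') b = 0 := by cases b <;> rfl

/-- [our object] **(Q-C3) THE SYMMETRISED `T₂` BORDER TABLE PACKED LIKE `vhSAt`** (sym twin of `vh₂SAt`; the record's `vh₂S κ u κ′ u′` up to the
row symmetrisation of `SymSecondOrderTablesAn1`): node 7a's packer applied to `s^{ρ,sym}` with the FIRST background bond `(κ, u)` closed over. -/
def symVh₂SAt (ρ : Fin (d + 1) → ℤ) (L : ℕ) (κ : Fin (d + 1)) (u : Fin (d + 1) → ℤ) :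
    Fin (d + 1) → (Fin (d + 1) → ℤ) → MKer (d + 1) (Fib d) :=
  packVH (fun μ y f f' => symVh2KerAt ρ L μ y f (κ, u) f') L

/-- [folklore] **(Tmix)** block-translation covariance of `symMixFFAt` (all roots) — the byte shape of the record's `hmixt`:
`M₂ κ (u + L·t) μ (y + t) = shiftK (−L·t) (M₂ κ u μ y)`. -/
theorem symMixFFAt_translate (ρ : Fin (d + 1) → ℤ) (L : ℕ) (κ : Fin (d + 1)) (u : Fin (d + 1) → ℤ) (μ : Fin (d + 1)) (y t : Fin (d + 1) → ℤ) :
    symMixFFAt ρ L κ (u + (L : ℤ) • t) μ (y + t) = shiftK (-((L : ℤ) • t)) (symMixFFAt ρ L κ u μ y) := by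
  funext x x' a b
  simp only [shiftK]
  rcases a with α | ν
  · rcases b with α' | ν'
    · rw [symMixFFAt_inl_inl, symMixFFAt_inl_inl]
      have h := symMixKerAt_add ρ L μ y t (κ, u) (α, x + -((L : ℤ) • t)) (α', x' + -((L : ℤ) • t))
      simp only [Bond.sh, neg_add_cancel_right] at h
      exact h
    · rw [symMixFFAt_inl_inr, symMixFFAt_inl_inr]
  · rw [symMixFFAt_inr, symMixFFAt_inr]

/-- [folklore] **(TB)** block-translation covariance of `symVh₂SAt` (`1 ≤ L`, all roots) — the byte shape of the record's `hBt`: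
`S₂ κ (u + L·t) κ′ (u′ + L·t) = shiftK (−L·t) (S₂ κ u κ′ u′)`. -/
theorem symVh₂SAt_translate {L : ℕ} (hL : 1 ≤ L) (ρ : Fin (d + 1) → ℤ) (κ : Fin (d + 1)) (u : Fin (d + 1) → ℤ) (κ' : Fin (d + 1))
    (u' t : Fin (d + 1) → ℤ) :
    symVh₂SAt ρ L κ (u + (L : ℤ) • t) κ' (u' + (L : ℤ) • t) = shiftK (-((L : ℤ) • t)) (symVh₂SAt ρ L κ u κ' u') := by
  funext x z a b
  simp only [symVh₂SAt, shiftK]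
  have e1 : ∀ w : Fin (d + 1) → ℤ, w + -((L : ℤ) • t) = w + (L : ℤ) • (-t) := fun w => by rw [smul_neg]
  rcases a with α | μ <;> rcases b with α' | μ'
  · rw [packVH_inl_inl, packVH_inl_inl]
  · rw [packVH_inl_inr, packVH_inl_inr, e1, e1, off_add_smul, blk_add_smul hL]
    split_ifs with hz
    · have h := symVh2KerAt_add ρ L μ' (blk L z + -t) t (α, x + (L : ℤ) • -t) (κ, u) (κ', u')
      rw [neg_add_cancel_right] at h
      rw [← h]
      congr 1; simp [Bond.sh, smul_neg]
    · rfl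
  · rw [packVH_inr_inl, packVH_inr_inl, e1, e1, off_add_smul, blk_add_smul hL]
    split_ifs with hx
    · have h := symVh2KerAt_add ρ L μ (blk L x + -t) t (α', z + (L : ℤ) • -t) (κ, u) (κ', u')
      rw [neg_add_cancel_right] at h
      rw [← h]
      congr 1; simp [Bond.sh, smul_neg]
    · rfl
  · rw [packVH_inr_inr, packVH_inr_inr]

variable {r : Fin (d + 1) → ℕ} {L : ℕ}

/-- [folklore] **(Lmix) `symMixFFAt` IS BI-LOCALISED AT THE BACKGROUND BOND** with the block-distance prefactor — the body of
`LocStencilFM L (symMixFFAt ρ L) C δ`, for EVERY rate `δ ≥ 0`, with the honest constant `C = symMixAbs ρ L · e^{6(d+1)Lδ}` (root offset in the box). -/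
theorem biLoc_symMixFFAt (hL : 1 ≤ L) (hr : r ∈ box (d + 1) L) {δ : ℝ} (hδ : 0 ≤ δ) (κ : Fin (d + 1)) (u : Fin (d + 1) → ℤ)
    (μ : Fin (d + 1)) (y : Fin (d + 1) → ℤ) :
    BiLoc (symMixFFAt (toSite r) L κ u μ y) u u
      (symMixAbs (toSite r) L * Real.exp (6 * ((d : ℝ) + 1) * L * δ) * Real.exp (-δ * l1 (u - (L : ℤ) • y))) δ := by
  intro x x' a b
  have hA := symMixAbs_nonneg (toSite r) L
  have hpos : 0 ≤ symMixAbs (toSite r) L * Real.exp (6 * ((d : ℝ) + 1) * L * δ) * Real.exp (-δ * l1 (u - (L : ℤ) • y))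
      * Real.exp (-δ * (l1 (x - u) + l1 (x' - u))) :=
    mul_nonneg (mul_nonneg (mul_nonneg hA (Real.exp_pos _).le) (Real.exp_pos _).le) (Real.exp_pos _).le
  rcases a with α | ν
  · rcases b with α' | ν'
    · rw [symMixFFAt_inl_inl, symMixKerAt]
      by_cases hu : Near L y u
      · by_cases hx : Near L y x
        · by_cases hx' : Near L y x'
          · have d0 := l1_le_of_near hu (near_self hL y)
            have d1 := l1_le_of_near hx hu
            have d2 := l1_le_of_near hx' hu
            have hb := abs_symTTab_le hr μ y (α, x) (α', x') (κ, u)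
            have h0 := l1_nonneg (u - (L : ℤ) • y)
            have h1' := l1_nonneg (x - u)
            have h2' := l1_nonneg (x' - u)
            have hsum : δ * l1 (u - (L : ℤ) • y) + δ * (l1 (x - u) + l1 (x' - u)) ≤ 6 * ((d : ℝ) + 1) * L * δ := by nlinarith
            have h1 : 1 ≤ Real.exp (6 * ((d : ℝ) + 1) * L * δ) * Real.exp (-δ * l1 (u - (L : ℤ) • y))
                * Real.exp (-δ * (l1 (x - u) + l1 (x' - u))) := by
              rw [← Real.exp_add, ← Real.exp_add]; exact Real.one_le_exp (by linarith)
            calc |(symTTab (toSite r) L μ y (α, x) (α', x') (κ, u) : ℝ)| ≤ symMixAbs (toSite r) L * 1 := by rw [mul_one]; exact hb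
              _ ≤ symMixAbs (toSite r) L * (Real.exp (6 * ((d : ℝ) + 1) * L * δ) * Real.exp (-δ * l1 (u - (L : ℤ) • y))
                    * Real.exp (-δ * (l1 (x - u) + l1 (x' - u)))) := mul_le_mul_of_nonneg_left h1 hA
              _ = _ := by ring
          · rw [symTTab_eq_zero₂ hr μ y _ hx', Rat.cast_zero, abs_zero]; exact hpos
        · rw [symTTab_eq_zero₁ hr μ y hx, Rat.cast_zero, abs_zero]; exact hpos
      · rw [symTTab_eq_zero₃ hr μ y _ _ hu, Rat.cast_zero, abs_zero]; exact hpos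
    · rw [symMixFFAt_inl_inr, abs_zero]; exact hpos
  · rw [symMixFFAt_inr, abs_zero]; exact hpos

/-- [folklore] **(LB) `symVh₂SAt κ u κ′ u′` IS BI-LOCALISED AT THE FIRST BACKGROUND BOND** with the prefactor `e^{−δ|u′ − u|₁}` — the body of
`LocStencil₂ (symVh₂SAt ρ L) C δ`, for EVERY rate `δ ≥ 0`, with the honest constant `C = symVh2Abs ρ L · e^{6(d+1)Lδ}` (root offset in the box). -/
theorem biLoc_symVh₂SAt (hL : 1 ≤ L) (hr : r ∈ box (d + 1) L) {δ : ℝ} (hδ : 0 ≤ δ) (κ : Fin (d + 1)) (u : Fin (d + 1) → ℤ)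
    (κ' : Fin (d + 1)) (u' : Fin (d + 1) → ℤ) :
    BiLoc (symVh₂SAt (toSite r) L κ u κ' u') u u
      (symVh2Abs (toSite r) L * Real.exp (6 * ((d : ℝ) + 1) * L * δ) * Real.exp (-δ * l1 (u' - u))) δ := by
  intro x z a b
  have hA := symVh2Abs_nonneg (toSite r) L
  have hpos : 0 ≤ symVh2Abs (toSite r) L * Real.exp (6 * ((d : ℝ) + 1) * L * δ) * Real.exp (-δ * l1 (u' - u))
      * Real.exp (-δ * (l1 (x - u) + l1 (z - u))) :=
    mul_nonneg (mul_nonneg (mul_nonneg hA (Real.exp_pos _).le) (Real.exp_pos _).le) (Real.exp_pos _).le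
  -- the generic estimate for a supported entry
  have key : ∀ (x z : Fin (d + 1) → ℤ) (μ α : Fin (d + 1)), off L z = 0 →
      |symVh2KerAt (toSite r) L μ (blk L z) (α, x) (κ, u) (κ', u')|
        ≤ symVh2Abs (toSite r) L * Real.exp (6 * ((d : ℝ) + 1) * L * δ) * Real.exp (-δ * l1 (u' - u))
            * Real.exp (-δ * (l1 (x - u) + l1 (z - u))) := by
    intro x z μ α hz
    have hpos' : 0 ≤ symVh2Abs (toSite r) L * Real.exp (6 * ((d : ℝ) + 1) * L * δ) * Real.exp (-δ * l1 (u' - u))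
        * Real.exp (-δ * (l1 (x - u) + l1 (z - u))) :=
      mul_nonneg (mul_nonneg (mul_nonneg hA (Real.exp_pos _).le) (Real.exp_pos _).le) (Real.exp_pos _).le
    rw [symVh2KerAt]
    by_cases hx : Near L (blk L z) x
    · by_cases hu : Near L (blk L z) u
      · by_cases hu' : Near L (blk L z) u'
        · have hz' : Near L (blk L z) z := by
            have h0 := near_self hL (blk L z)
            rwa [← eq_smul_blk_of_off_eq_zero hL hz] at h0
          have d1 := l1_le_of_near hx hu
          have d2 := l1_le_of_near hz' hu
          have d3 := l1_le_of_near hu' hu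
          have e1 := l1_nonneg (x - u)
          have e2 := l1_nonneg (z - u)
          have e3 := l1_nonneg (u' - u)
          have hsum : δ * l1 (u' - u) + δ * (l1 (x - u) + l1 (z - u)) ≤ 6 * ((d : ℝ) + 1) * L * δ := by nlinarith
          have h1 : 1 ≤ Real.exp (6 * ((d : ℝ) + 1) * L * δ) * Real.exp (-δ * l1 (u' - u))
              * Real.exp (-δ * (l1 (x - u) + l1 (z - u))) := by
            rw [← Real.exp_add, ← Real.exp_add]; exact Real.one_le_exp (by linarith)
          have hb := abs_symVh2Tab_le hr μ (blk L z) (α, x) (κ, u) (κ', u')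
          calc |(symVh2Tab (toSite r) L μ (blk L z) (α, x) (κ, u) (κ', u') : ℝ)| ≤ symVh2Abs (toSite r) L * 1 := by
                rw [mul_one]; exact hb
            _ ≤ symVh2Abs (toSite r) L * (Real.exp (6 * ((d : ℝ) + 1) * L * δ) * Real.exp (-δ * l1 (u' - u))
                  * Real.exp (-δ * (l1 (x - u) + l1 (z - u)))) := mul_le_mul_of_nonneg_left h1 hA
            _ = _ := by ring
        · rw [symVh2Tab_eq_zero₃ hr μ _ _ _ hu', Rat.cast_zero, abs_zero]; exact hpos'
      · rw [symVh2Tab_eq_zero₂ hr μ _ _ hu, Rat.cast_zero, abs_zero]; exact hpos'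
    · rw [symVh2Tab_eq_zero₁ hr μ _ hx, Rat.cast_zero, abs_zero]; exact hpos'
  rcases a with α | μ <;> rcases b with α' | μ'
  · rw [symVh₂SAt, packVH_inl_inl, abs_zero]; exact hpos
  · rw [symVh₂SAt, packVH_inl_inr]
    split_ifs with hz
    · exact key x z μ' α hz
    · rw [abs_zero]; exact hpos
  · rw [symVh₂SAt, packVH_inr_inl]
    split_ifs with hx
    · rw [add_comm (l1 (x - u))]; exact key z x μ α' hx
    · rw [abs_zero]; exact hpos
  · rw [symVh₂SAt, packVH_inr_inr, abs_zero]; exact hpos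

/-- [folklore] `symVh₂SAt κ u κ′ u′` is symmetric (a packed stencil). -/
theorem symVh₂SAt_symm (ρ : Fin (d + 1) → ℤ) (L : ℕ) (κ : Fin (d + 1)) (u : Fin (d + 1) → ℤ) (κ' : Fin (d + 1))
    (u' x z : Fin (d + 1) → ℤ) (a b : Fib d) : symVh₂SAt ρ L κ u κ' u' x z a b = symVh₂SAt ρ L κ u κ' u' z x b a :=
  packVH_symm _ L κ' u' x z a b

/-- [folklore] The `(inl, inl)` block of `symVh₂SAt` vanishes (node 7a's packer). -/
@[simp] theorem symVh₂SAt_inl_inl (ρ : Fin (d + 1) → ℤ) (L : ℕ) (κ : Fin (d + 1)) (u : Fin (d + 1) → ℤ) (κ' : Fin (d + 1))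
    (u' x z : Fin (d + 1) → ℤ) (α α' : Fin (d + 1)) : symVh₂SAt ρ L κ u κ' u' x z (Sum.inl α) (Sum.inl α') = 0 := rfl

/-- [folklore] The `(inr, inr)` block of `symVh₂SAt` vanishes (node 7a's packer). -/
@[simp] theorem symVh₂SAt_inr_inr (ρ : Fin (d + 1) → ℤ) (L : ℕ) (κ : Fin (d + 1)) (u : Fin (d + 1) → ℤ) (κ' : Fin (d + 1))
    (u' x z : Fin (d + 1) → ℤ) (ν ν' : Fin (d + 1)) : symVh₂SAt ρ L κ u κ' u' x z (Sum.inr ν) (Sum.inr ν') = 0 := rfl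

end Packed

end

end Summit.QuantumFields.BalabanUV.Beta.SymAveragingMixedJetTables
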